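import Summits.Ventures.HodgeRepro2.T5SU11JacobiCovarianceRateOutside

/-!
# The rates for EVERY real spectral parameter, in one formula each: with `μ = |λ(λ − 2)|`,
`|(k − 2) m̂_k(λ)/(2π) − 1| ≤ μ/(k − 2)`, `|k ⟨log|a|⟩ − 1| ≤ (16 + 4μ + 5μ²)/k`, `|k² Var(log|a|) − 1| ≤ (352 + 136μ + 77μ² + 25μ³ + 2μ⁴)/k`, …

The rate chapter was proved on the Jensen range `0 ≤ λ ≤ 2` (`T5SU11JacobiMeanPhaseRate`, `T5SU11JacobiCovarianceRate`,
`T5SU11JacobiWeightRate`) with absolute constants, and outside it (`T5SU11JacobiPhaseLowerOutside`,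
`T5SU11JacobiMeanPhaseRateOutside`, `T5SU11JacobiCovarianceRateOutside`) with constants polynomial in
`c' = λ(λ − 2)/2`. Since `|λ(λ − 2)| ≤ 1` on the Jensen range and `= 2c'` outside, ONE polynomial in
`μ := |λ(λ − 2)|` dominates both, and the threshold `k ≥ μ + 4` covers both `k ≥ 4` and `k ≥ 2c' + 4`. Hence, for
EVERY real `λ`:

* **`|(k − 2) m̂_k(λ)/(2π) − 1| ≤ μ/(k − 2)`** for `k ≥ μ + 2` (`abs_weight_ratio_sub_one_le`) — the quantitative form
  of `(k − 2) m̂_k(λ) → 2π` with the Casimir-type constant as the rate constant;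
* **`|k ⟨log|a|⟩_{k,λ} − 1| ≤ (16 + 4μ + 5μ²)/k`** for `k ≥ μ + 4` (`abs_mul_mean_phase_sub_one_le_all`);
* **`|k² ⟨(log|a|)²⟩_{k,λ} − 2| ≤ (256 + 32μ + 27μ² + 2μ⁴)/k`** (`abs_sq_mul_second_moment_sub_two_le_all`);
* **`|k² Var_{k,λ}(log|a|) − 1| ≤ (352 + 136μ + 77μ² + 25μ³ + 2μ⁴)/k`** (`abs_sq_mul_variance_phase_sub_one_le_all`);
* **`|(k²/2) Cov_{k,λ}(log|a|, |g·0|²) − 1| ≤ (358 + 137μ + 77μ² + 25μ³ + 2μ⁴)/k`**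
  (`abs_sq_div_two_mul_covariance_sub_one_le_all`);
* **`|ρ_{k,λ} − 1| ≤ C(μ)/k`** for `k ≥ 2(352 + 136μ + 77μ² + 25μ³ + 2μ⁴)` (`abs_correlation_phase_orbit_sq_sub_one_le_all`).

Constants explicit, not optimised. Nothing is claimed about (N).

Blind lane: Mathlib + the HodgeRepro2 prefix only; no sorry; axioms ⊆ {propext, Classical.choice,
Quot.sound}.
-/

namespace Summit.Ventures.HodgeRepro2.T5SU11JacobiRatesAll

open MeasureTheory MeasureTheory.Measure Metric Set Filter Topology
open T5SU11Unimodular T5SU11Fibration T5SU11Cartan T5SU11OneParameter T5SU11CartanProjection T5HaarCircle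
  T5BergmanCoefficient T5SU11FibrationHaar T5SU11SphericalFunction T5SU11SphericalSymmetry
  T5SU11SphericalBounds T5SU11SphericalContinuous T5SU11JacobiLaplacePhase T5SU11PhaseLawLintegral
  T5SU11JacobiWeightDerivAll T5SU11JacobiPhaseTailGroup T5SU11JacobiPhaseLawRate T5SU11JacobiMeanPhaseRate
  T5SU11JacobiPhaseLawRateOutside T5SU11JacobiWeightRate T5SU11JacobiPhaseLowerOutside
  T5SU11JacobiMeanPhaseOutside T5SU11JacobiMeanPhaseRateOutside T5SU11JacobiCovarianceRate
  T5SU11JacobiCovarianceRateOutside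
open scoped Real

/-- On the Jensen range `μ = |λ(λ − 2)| = λ(2 − λ) ≤ 1`. -/
theorem abs_mul_sub_two_of_Icc {lam : ℝ} (h0 : 0 ≤ lam) (h2 : lam ≤ 2) :
    |lam * (lam - 2)| = lam * (2 - lam) := by
  rw [abs_of_nonpos (by nlinarith)]
  ring

/-- Outside the Jensen range `μ = |λ(λ − 2)| = λ(λ − 2) = 2c'`. -/
theorem abs_mul_sub_two_of_not_Icc {lam : ℝ} (h : 2 ≤ lam ∨ lam ≤ 0) : |lam * (lam - 2)| = lam * (lam - 2) := by
  rcases h with h | h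
  · exact abs_of_nonneg (mul_nonneg (by linarith) (by linarith))
  · exact abs_of_nonneg (mul_nonneg_of_nonpos_of_nonpos h (by linarith))

section measure

variable [MeasurableSpace Circle] [BorelSpace Circle]

/-- **THE RATE OF THE TRANSFORM FOR EVERY REAL `λ`**: `|(k − 2) m̂_k(λ)/(2π) − 1| ≤ |λ(λ − 2)|/(k − 2)` for
`k ≥ |λ(λ − 2)| + 2` (strictly: `k − 2 > |λ(λ − 2)|`, which is also what puts `k` on the ray). -/
theorem abs_weight_ratio_sub_one_le {k lam : ℝ} (hk : |lam * (lam - 2)| + 2 < k) :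
    |(k - 2) * (∫ g, (1 - ‖orbit g‖ ^ 2) ^ (k / 2) * sph lam g ∂(nu haarCircle)) / (2 * π) - 1|
      ≤ |lam * (lam - 2)| / (k - 2) := by
  have hr : 0 < k - 2 := by linarith [abs_nonneg (lam * (lam - 2))]
  rcases le_or_gt 0 lam with h0 | h0
  · rcases le_or_gt lam 2 with h2 | h2
    · -- the Jensen range: `1 − c/r ≤ ratio ≤ 1`, `c = λ(2 − λ)/2 ≤ μ`
      rw [abs_mul_sub_two_of_Icc h0 h2] at hk ⊢
      have hU := weight_ratio_le_one (k := k) (by linarith) h0 h2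
      have hL := one_sub_le_weight_ratio (k := k) (by linarith) h0 h2
      have hc : lam * (2 - lam) / 2 / (k - 2) ≤ lam * (2 - lam) / (k - 2) := by
        apply div_le_div_of_nonneg_right _ hr.le
        nlinarith
      have hμ0 : 0 ≤ lam * (2 - lam) / (k - 2) := by
        apply div_nonneg (mul_nonneg h0 (by linarith)) hr.le
      rw [abs_le]
      constructor <;> linarith
    · -- `λ > 2`: `1 + c'/r ≤ ratio ≤ r/(r − c')`, `c' = μ/2`
      rw [abs_mul_sub_two_of_not_Icc (Or.inl h2.le)] at hk ⊢
      have hc' : lam * (lam - 2) / 2 < k - 2 := by linarith [mul_nonneg (by linarith : (0:ℝ) ≤ lam) (by linarith : (0:ℝ) ≤ lam - 2)]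
      have hU := weight_ratio_le_of_two_le h2.le hc'
      have hL := one_add_le_weight_ratio_of_two_le h2.le hc'
      have hμ0 : 0 ≤ lam * (lam - 2) := mul_nonneg (by linarith) (by linarith)
      have hrc : 0 < k - 2 - lam * (lam - 2) / 2 := by linarith
      have hU' : (k - 2) / (k - 2 - lam * (lam - 2) / 2) - 1 ≤ lam * (lam - 2) / (k - 2) := by
        rw [div_sub_one hrc.ne', div_le_div_iff₀ hrc hr]
        nlinarith [mul_nonneg hμ0 hμ0]
      have hL' : 0 ≤ lam * (lam - 2) / 2 / (k - 2) := by positivity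
      have hL'' : lam * (lam - 2) / 2 / (k - 2) ≤ lam * (lam - 2) / (k - 2) := by
        apply div_le_div_of_nonneg_right _ hr.le
        linarith
      rw [abs_le]
      constructor <;> linarith
  · -- `λ < 0`: the twin statements
    rw [abs_mul_sub_two_of_not_Icc (Or.inr h0.le)] at hk ⊢
    have hμ0 : 0 ≤ lam * (lam - 2) := mul_nonneg_of_nonpos_of_nonpos h0.le (by linarith)
    have hc' : lam * (lam - 2) / 2 < k - 2 := by linarith
    have hU := weight_ratio_le_of_nonpos h0.le hc'
    have hL := one_add_le_weight_ratio_of_nonpos h0.le hc'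
    have hrc : 0 < k - 2 - lam * (lam - 2) / 2 := by linarith
    have hU' : (k - 2) / (k - 2 - lam * (lam - 2) / 2) - 1 ≤ lam * (lam - 2) / (k - 2) := by
      rw [div_sub_one hrc.ne', div_le_div_iff₀ hrc hr]
      nlinarith [mul_nonneg hμ0 hμ0]
    have hL' : 0 ≤ lam * (lam - 2) / 2 / (k - 2) := by positivity
    have hL'' : lam * (lam - 2) / 2 / (k - 2) ≤ lam * (lam - 2) / (k - 2) := by
      apply div_le_div_of_nonneg_right _ hr.le
      linarith
    rw [abs_le]
    constructor <;> linarith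

/-- **THE RATE OF THE MEAN PHASE FOR EVERY REAL `λ`**: `|k ⟨log|a|⟩_{k,λ} − 1| ≤ (16 + 4μ + 5μ²)/k` for
`k ≥ μ + 4`, `μ = |λ(λ − 2)|`. -/
theorem abs_mul_mean_phase_sub_one_le_all {k lam : ℝ} (hk : |lam * (lam - 2)| + 4 ≤ k) :
    |k * ((∫ g, Real.log ‖mat g 0 0‖ * ((1 - ‖orbit g‖ ^ 2) ^ (k / 2) * sph lam g) ∂(nu haarCircle))
        / (∫ g, (1 - ‖orbit g‖ ^ 2) ^ (k / 2) * sph lam g ∂(nu haarCircle))) - 1|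
      ≤ (16 + 4 * |lam * (lam - 2)| + 5 * |lam * (lam - 2)| ^ 2) / k := by
  have hk0 : 0 < k := by linarith [abs_nonneg (lam * (lam - 2))]
  have hμ0 : 0 ≤ |lam * (lam - 2)| := abs_nonneg _
  rcases le_or_gt 0 lam with h0 | h0
  · rcases le_or_gt lam 2 with h2 | h2
    · have h := abs_mul_mean_phase_sub_one_le (k := k) (by linarith) h0 h2
      refine h.trans (div_le_div_of_nonneg_right ?_ hk0.le)
      nlinarith [sq_nonneg |lam * (lam - 2)|]
    · rw [abs_mul_sub_two_of_not_Icc (Or.inl h2.le)] at hk ⊢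
      have h := abs_mul_mean_phase_sub_one_le_of_two_le (k := k) h2.le (by linarith)
      refine h.trans (le_of_eq ?_)
      ring
  · rw [abs_mul_sub_two_of_not_Icc (Or.inr h0.le)] at hk ⊢
    have h := abs_mul_mean_phase_sub_one_le_of_nonpos (k := k) h0.le (by linarith)
    refine h.trans (le_of_eq ?_)
    ring

/-- **THE RATE OF THE SECOND MOMENT FOR EVERY REAL `λ`**: `|k² ⟨(log|a|)²⟩_{k,λ} − 2| ≤ (256 + 32μ + 27μ² + 2μ⁴)/k`
for `k ≥ μ + 4`. -/
theorem abs_sq_mul_second_moment_sub_two_le_all {k lam : ℝ} (hk : |lam * (lam - 2)| + 4 ≤ k) :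
    |k ^ 2 * ((∫ g, Real.log ‖mat g 0 0‖ ^ 2 * ((1 - ‖orbit g‖ ^ 2) ^ (k / 2) * sph lam g) ∂(nu haarCircle))
        / (∫ g, (1 - ‖orbit g‖ ^ 2) ^ (k / 2) * sph lam g ∂(nu haarCircle))) - 2|
      ≤ (256 + 32 * |lam * (lam - 2)| + 27 * |lam * (lam - 2)| ^ 2 + 2 * |lam * (lam - 2)| ^ 4) / k := by
  have hk0 : 0 < k := by linarith [abs_nonneg (lam * (lam - 2))]
  have hμ0 : 0 ≤ |lam * (lam - 2)| := abs_nonneg _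
  rcases le_or_gt 0 lam with h0 | h0
  · rcases le_or_gt lam 2 with h2 | h2
    · have h := abs_sq_mul_second_moment_sub_two_le (k := k) (by linarith) h0 h2
      refine h.trans (div_le_div_of_nonneg_right ?_ hk0.le)
      nlinarith [sq_nonneg |lam * (lam - 2)|, pow_nonneg hμ0 4]
    · rw [abs_mul_sub_two_of_not_Icc (Or.inl h2.le)] at hk ⊢
      have h := abs_sq_mul_second_moment_sub_two_le_of_two_le (k := k) h2.le (by linarith)
      refine h.trans (le_of_eq ?_)
      ring
  · rw [abs_mul_sub_two_of_not_Icc (Or.inr h0.le)] at hk ⊢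
    have e : (2 - lam) * (2 - lam - 2) / 2 = lam * (lam - 2) / 2 := by ring
    have h := abs_sq_mul_second_moment_sub_two_le_of_two_le (lam := 2 - lam) (k := k) (by linarith)
      (by rw [e]; linarith)
    rw [e] at h
    simp_rw [← sph_two_sub lam] at h
    refine h.trans (le_of_eq ?_)
    ring

/-- **THE RATE OF THE VARIANCE FOR EVERY REAL `λ`**:
`|k² Var_{k,λ}(log|a|) − 1| ≤ (352 + 136μ + 77μ² + 25μ³ + 2μ⁴)/k` for `k ≥ μ + 4`. -/
theorem abs_sq_mul_variance_phase_sub_one_le_all {k lam : ℝ} (hk : |lam * (lam - 2)| + 4 ≤ k) :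
    |k ^ 2 * ((∫ g, Real.log ‖mat g 0 0‖ ^ 2 * ((1 - ‖orbit g‖ ^ 2) ^ (k / 2) * sph lam g) ∂(nu haarCircle))
          / (∫ g, (1 - ‖orbit g‖ ^ 2) ^ (k / 2) * sph lam g ∂(nu haarCircle))
        - ((∫ g, Real.log ‖mat g 0 0‖ * ((1 - ‖orbit g‖ ^ 2) ^ (k / 2) * sph lam g) ∂(nu haarCircle))
          / (∫ g, (1 - ‖orbit g‖ ^ 2) ^ (k / 2) * sph lam g ∂(nu haarCircle))) ^ 2) - 1|
      ≤ (352 + 136 * |lam * (lam - 2)| + 77 * |lam * (lam - 2)| ^ 2 + 25 * |lam * (lam - 2)| ^ 3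
          + 2 * |lam * (lam - 2)| ^ 4) / k := by
  have hk0 : 0 < k := by linarith [abs_nonneg (lam * (lam - 2))]
  have hμ0 : 0 ≤ |lam * (lam - 2)| := abs_nonneg _
  rcases le_or_gt 0 lam with h0 | h0
  · rcases le_or_gt lam 2 with h2 | h2
    · have h := abs_sq_mul_variance_phase_sub_one_le (k := k) (by linarith) h0 h2
      refine h.trans (div_le_div_of_nonneg_right ?_ hk0.le)
      nlinarith [sq_nonneg |lam * (lam - 2)|, pow_nonneg hμ0 3, pow_nonneg hμ0 4]
    · rw [abs_mul_sub_two_of_not_Icc (Or.inl h2.le)] at hk ⊢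
      have h := abs_sq_mul_variance_phase_sub_one_le_of_two_le (k := k) h2.le (by linarith)
      refine h.trans (le_of_eq ?_)
      ring
  · rw [abs_mul_sub_two_of_not_Icc (Or.inr h0.le)] at hk ⊢
    have h := abs_sq_mul_variance_phase_sub_one_le_of_nonpos (k := k) h0.le (by linarith)
    refine h.trans (le_of_eq ?_)
    ring

/-- **THE RATE OF THE RESCALED COVARIANCE FOR EVERY REAL `λ`**:
`|(k²/2) Cov_{k,λ}(log|a|, |g·0|²) − 1| ≤ (358 + 137μ + 77μ² + 25μ³ + 2μ⁴)/k` for `k ≥ μ + 4`. -/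
theorem abs_sq_div_two_mul_covariance_sub_one_le_all {k lam : ℝ} (hk : |lam * (lam - 2)| + 4 ≤ k) :
    |k ^ 2 / 2 *
      ((∫ g, Real.log ‖mat g 0 0‖ * ‖orbit g‖ ^ 2 * ((1 - ‖orbit g‖ ^ 2) ^ (k / 2) * sph lam g)
            ∂(nu haarCircle))
          / (∫ g, (1 - ‖orbit g‖ ^ 2) ^ (k / 2) * sph lam g ∂(nu haarCircle))
        - ((∫ g, Real.log ‖mat g 0 0‖ * ((1 - ‖orbit g‖ ^ 2) ^ (k / 2) * sph lam g) ∂(nu haarCircle))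
            / (∫ g, (1 - ‖orbit g‖ ^ 2) ^ (k / 2) * sph lam g ∂(nu haarCircle)))
          * ((∫ g, ‖orbit g‖ ^ 2 * ((1 - ‖orbit g‖ ^ 2) ^ (k / 2) * sph lam g) ∂(nu haarCircle))
            / (∫ g, (1 - ‖orbit g‖ ^ 2) ^ (k / 2) * sph lam g ∂(nu haarCircle)))) - 1|
      ≤ (358 + 137 * |lam * (lam - 2)| + 77 * |lam * (lam - 2)| ^ 2 + 25 * |lam * (lam - 2)| ^ 3
          + 2 * |lam * (lam - 2)| ^ 4) / k := by
  have hk0 : 0 < k := by linarith [abs_nonneg (lam * (lam - 2))]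
  have hμ0 : 0 ≤ |lam * (lam - 2)| := abs_nonneg _
  rcases le_or_gt 0 lam with h0 | h0
  · rcases le_or_gt lam 2 with h2 | h2
    · have h := abs_sq_div_two_mul_covariance_sub_one_le (k := k) (by linarith) h0 h2
      refine h.trans (div_le_div_of_nonneg_right ?_ hk0.le)
      nlinarith [sq_nonneg |lam * (lam - 2)|, pow_nonneg hμ0 3, pow_nonneg hμ0 4]
    · rw [abs_mul_sub_two_of_not_Icc (Or.inl h2.le)] at hk ⊢
      have h := abs_sq_div_two_mul_covariance_sub_one_le_of_two_le (k := k) h2.le (by linarith)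
      refine h.trans (div_le_div_of_nonneg_right ?_ hk0.le)
      nlinarith [mul_nonneg (by linarith : (0 : ℝ) ≤ lam) (by linarith : (0 : ℝ) ≤ lam - 2)]
  · rw [abs_mul_sub_two_of_not_Icc (Or.inr h0.le)] at hk ⊢
    have h := abs_sq_div_two_mul_covariance_sub_one_le_of_nonpos (k := k) h0.le (by linarith)
    refine h.trans (div_le_div_of_nonneg_right ?_ hk0.le)
    nlinarith [mul_nonneg_of_nonpos_of_nonpos h0.le (by linarith : lam - 2 ≤ 0)]

/-- **THE RATE OF THE CORRELATION COEFFICIENT FOR EVERY REAL `λ`**: with `μ = |λ(λ − 2)|` and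
`C_V(μ) = 352 + 136μ + 77μ² + 25μ³ + 2μ⁴`, for `k ≥ 2 C_V(μ)`,
`|ρ_{k,λ} − 1| ≤ 2((358 + 137μ + 77μ² + 25μ³ + 2μ⁴) + 2 C_V(μ) + (12 + 5μ + μ²/2))/k`
(`T5SU11JacobiCovarianceRate.abs_correlation_phase_orbit_sq_sub_one_le` on the Jensen range,
`T5SU11JacobiCovarianceRateOutside.abs_correlation_phase_orbit_sq_sub_one_le_of_two_le` outside). -/
theorem abs_correlation_phase_orbit_sq_sub_one_le_all {k lam : ℝ}
    (hk : 2 * (352 + 136 * |lam * (lam - 2)| + 77 * |lam * (lam - 2)| ^ 2 + 25 * |lam * (lam - 2)| ^ 3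
      + 2 * |lam * (lam - 2)| ^ 4) ≤ k) :
    |((∫ g, Real.log ‖mat g 0 0‖ * ‖orbit g‖ ^ 2 * ((1 - ‖orbit g‖ ^ 2) ^ (k / 2) * sph lam g)
            ∂(nu haarCircle))
          / (∫ g, (1 - ‖orbit g‖ ^ 2) ^ (k / 2) * sph lam g ∂(nu haarCircle))
        - ((∫ g, Real.log ‖mat g 0 0‖ * ((1 - ‖orbit g‖ ^ 2) ^ (k / 2) * sph lam g) ∂(nu haarCircle))
            / (∫ g, (1 - ‖orbit g‖ ^ 2) ^ (k / 2) * sph lam g ∂(nu haarCircle)))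
          * ((∫ g, ‖orbit g‖ ^ 2 * ((1 - ‖orbit g‖ ^ 2) ^ (k / 2) * sph lam g) ∂(nu haarCircle))
            / (∫ g, (1 - ‖orbit g‖ ^ 2) ^ (k / 2) * sph lam g ∂(nu haarCircle))))
      / Real.sqrt
        (((∫ g, Real.log ‖mat g 0 0‖ ^ 2 * ((1 - ‖orbit g‖ ^ 2) ^ (k / 2) * sph lam g) ∂(nu haarCircle))
            / (∫ g, (1 - ‖orbit g‖ ^ 2) ^ (k / 2) * sph lam g ∂(nu haarCircle))
          - ((∫ g, Real.log ‖mat g 0 0‖ * ((1 - ‖orbit g‖ ^ 2) ^ (k / 2) * sph lam g) ∂(nu haarCircle))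
            / (∫ g, (1 - ‖orbit g‖ ^ 2) ^ (k / 2) * sph lam g ∂(nu haarCircle))) ^ 2)
        * ((∫ g, (‖orbit g‖ ^ 2) ^ 2 * ((1 - ‖orbit g‖ ^ 2) ^ (k / 2) * sph lam g) ∂(nu haarCircle))
            / (∫ g, (1 - ‖orbit g‖ ^ 2) ^ (k / 2) * sph lam g ∂(nu haarCircle))
          - ((∫ g, ‖orbit g‖ ^ 2 * ((1 - ‖orbit g‖ ^ 2) ^ (k / 2) * sph lam g) ∂(nu haarCircle))
            / (∫ g, (1 - ‖orbit g‖ ^ 2) ^ (k / 2) * sph lam g ∂(nu haarCircle))) ^ 2)) - 1|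
      ≤ 2 * ((358 + 137 * |lam * (lam - 2)| + 77 * |lam * (lam - 2)| ^ 2 + 25 * |lam * (lam - 2)| ^ 3
            + 2 * |lam * (lam - 2)| ^ 4)
          + 2 * (352 + 136 * |lam * (lam - 2)| + 77 * |lam * (lam - 2)| ^ 2 + 25 * |lam * (lam - 2)| ^ 3
            + 2 * |lam * (lam - 2)| ^ 4)
          + (12 + 5 * |lam * (lam - 2)| + |lam * (lam - 2)| ^ 2 / 2)) / k := by
  have hμ0 : 0 ≤ |lam * (lam - 2)| := abs_nonneg _
  set μ : ℝ := |lam * (lam - 2)| with hμ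
  have hk0 : 0 < k := by nlinarith [pow_nonneg hμ0 2, pow_nonneg hμ0 3, pow_nonneg hμ0 4]
  rcases le_or_gt 0 lam with h0 | h0
  · rcases le_or_gt lam 2 with h2 | h2
    · -- the Jensen range: the constant `498` at `k ≥ 150`
      have h150 : (150 : ℝ) ≤ k := by nlinarith [pow_nonneg hμ0 2, pow_nonneg hμ0 3, pow_nonneg hμ0 4]
      have h := abs_correlation_phase_orbit_sq_sub_one_le (k := k) h150 h0 h2
      refine h.trans (div_le_div_of_nonneg_right ?_ hk0.le)
      nlinarith [pow_nonneg hμ0 2, pow_nonneg hμ0 3, pow_nonneg hμ0 4]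
    · -- `λ > 2`: `μ = 2c'`
      have hc : lam * (lam - 2) / 2 = μ / 2 := by
        rw [hμ, abs_mul_sub_two_of_not_Icc (Or.inl h2.le)]
      have hk2 : 2 * (352 + 272 * (lam * (lam - 2) / 2) + 308 * (lam * (lam - 2) / 2) ^ 2
          + 200 * (lam * (lam - 2) / 2) ^ 3 + 32 * (lam * (lam - 2) / 2) ^ 4) ≤ k := by
        rw [hc]
        nlinarith [pow_nonneg hμ0 2, pow_nonneg hμ0 3, pow_nonneg hμ0 4]
      have h := abs_correlation_phase_orbit_sq_sub_one_le_of_two_le (k := k) h2.le hk2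
      rw [hc] at h
      refine h.trans (div_le_div_of_nonneg_right ?_ hk0.le)
      nlinarith [pow_nonneg hμ0 2, pow_nonneg hμ0 3, pow_nonneg hμ0 4]
  · -- `λ < 0`: by the functional equation, `μ = 2c'` again
    have hc : lam * (lam - 2) / 2 = μ / 2 := by
      rw [hμ, abs_mul_sub_two_of_not_Icc (Or.inr h0.le)]
    have e : (2 - lam) * (2 - lam - 2) / 2 = lam * (lam - 2) / 2 := by ring
    have hk2 : 2 * (352 + 272 * ((2 - lam) * (2 - lam - 2) / 2) + 308 * ((2 - lam) * (2 - lam - 2) / 2) ^ 2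
        + 200 * ((2 - lam) * (2 - lam - 2) / 2) ^ 3 + 32 * ((2 - lam) * (2 - lam - 2) / 2) ^ 4) ≤ k := by
      rw [e, hc]
      nlinarith [pow_nonneg hμ0 2, pow_nonneg hμ0 3, pow_nonneg hμ0 4]
    have h := abs_correlation_phase_orbit_sq_sub_one_le_of_two_le (lam := 2 - lam) (k := k) (by linarith) hk2
    rw [e, hc] at h
    simp_rw [← sph_two_sub lam] at h
    refine h.trans (div_le_div_of_nonneg_right ?_ hk0.le)
    nlinarith [pow_nonneg hμ0 2, pow_nonneg hμ0 3, pow_nonneg hμ0 4]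

end measure

end Summit.Ventures.HodgeRepro2.T5SU11JacobiRatesAll
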